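import Mathlib
import Summits.Ventures.HodgeRepro.Tier4.Line4.TorusFinSplit
import Summits.Ventures.HodgeRepro.Tier4.Line4.LevelSplit
import Summits.Ventures.HodgeRepro.Tier4.Line4.LevelIndexUniform
import Summits.Ventures.HodgeRepro.Tier4.Line4.LevelIndicatorAverage
import Summits.Ventures.HodgeRepro.Tier4.Common.CosetCoveringBound
import Summits.Ventures.HodgeRepro.Tier4.Common.IndexMeasure
import Summits.Ventures.HodgeRepro.Tier4.Line4.CentreFinDomain
import Summits.Ventures.HodgeRepro.Tier4.Line4.SuppMeasure

/-!
# Tier4/Line4/CurrencyMatch — C-L4-CURRENCY: the (F-c) currency `c · ν_S((Z_S ⊓ B(1)) · B(qⁿ)) · ν^{(q)}(π^{(q)} C)` is at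
most a constant times the unit's currency `ν_f(Z⁰_f · levelTf (q^{n+c₀}))`

Blind re-derivation cell `pub-hodge-repro`, Tier 4 «prove the step» (README §9–§10), seat t4-L1-p4 (gen 5; LINE L4; the
`hcur` binder of RatioGlue p711153 `unit_of_currency_of_beta`, S15776).  Tree path
`lean/Summits/Ventures/HodgeRepro/Tier4/Line4/CurrencyMatch.lean`.  Imports: L2-p1's PSPLIT (`Line4/TorusFinSplit`:
`torusFinSplit`, `atTf`, `awayTf`, the local compactness / second countability of the factors; `Line4/LevelSplit`: `placesAbove`, `mem_levelK_pow_iff_of_mem_trivialOn`),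
L4-p2's P3 (`Line4/LevelIndexUniform`: `exists_finset_cover_inf_levelK_mul`) and `Line4/LevelIndicatorAverage`
(`isOpen_preimage_levelK_of_continuous`), typer-1's `Common/CosetCoveringBound` (`exists_finset_cover_smul_of_isCompact`) and
`Common/IndexMeasure` (`measure_le_card_mul_of_subset_biUnion_smul`), L2-p2's `Line4/CentreFinDomain` (`ZfIn`), L2-p1's
`Line4/SuppMeasure` (`levelTf`).  Mathlib-level; no literature; no `def` — the local tori `Z_S = centreAt`, `B(N) = levelAt N`
of L1-p1's (F-c) are written as the comaps they are (`(centre W).comap ι`, `(levelK W N).comap ι`,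
`ι := (finInc W).comp (torusFinAt W S).subtype` = `atInc W S`), so that (F-c) binds by `rfl`.

THE STATEMENT (`currency_match`), `S = placesAbove q`, `ν_f = c • (ν_S ⊗ ν_A)` along the split (P1), `C ⊆ T_f` compact:
`∃ M₃ ≠ ⊤, ∀ n, c · ν_S((Z_S ⊓ B(1)) · B(qⁿ)) · ν_A(π^{(q)} C) ≤ M₃ · ν_f((Z_f ∩ levelTf 1) · levelTf (q^{n+c₀}))`, with
`M₃ = M(q^{c₀}) · m_A`: (i) P3 — `B(qⁿ)` is covered by `≤ M(q^{c₀})` translates of `B(q^{n+c₀})` (the GA-cover of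
`exists_finset_cover_inf_levelK_mul` at `H := ι.range`, pulled back along the injective `ι`), hence, `Z_S` being central,
`(Z_S ⊓ B(1)) · B(qⁿ)` by as many translates of `(Z_S ⊓ B(1)) · B(q^{n+c₀})` — `measure_le_card_mul_of_subset_biUnion_smul`;
(ii) the compact `π^{(q)} C` is covered by `m_A` cosets of the open level-one box `B_A(1) = T^{(q)} ∩ K(1)`
(`exists_finset_cover_smul_of_isCompact`); (iii) the product set `(Z_S ⊓ B(1)) · B(q^{n+c₀}) × B_A(1)`, pulled back along the
split, lies in `(Z_f ∩ levelTf 1) · levelTf (q^{n+c₀})` — a central element of `T_S` is central in `T_f` and in `K(1)`, and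
the away part at level one is at every level `qⁿ` (`mem_levelK_pow_iff_of_mem_trivialOn`); (iv) `ν_f` of a split product is
`c · ν_S(·) · ν_A(·)` (`MeasurableEquiv.map_apply` on the split, `Measure.prod_prod`; no measurability needed).
Exponent bookkeeping: both currencies carry `[Z_S⁰ : Z_S⁰ ∩ B(qⁿ)] · ν(B(qⁿ))`, the ratio is `M(q^{c₀}) · m_A`, free of `n`.

Nothing here says anything about the status of the Hodge conjecture for CM abelian varieties, which is NOT proved
(HC_CM is NOT proved by anyone in this repository).
-/

set_option autoImplicit false
noncomputable section
namespace Summit.Ventures.HodgeRepro.Tier4.Line4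
open Summit.Ventures.HodgeRepro.Tier4 Summit.Ventures.HodgeRepro.Tier4.Common
  Summit.Ventures.HodgeRepro.Tier4.Line1 MeasureTheory IsDedekindDomain NumberField
open scoped ENNReal NNReal Pointwise

section Inclusions
variable {k : Type} [Field k] [NumberField k] (W : PlaneData k) (S : Set (HeightOneSpectrum (𝓞 k)))

/-- The inclusion `T_S → G(𝔸)` (= L1-p1's `atInc`) is injective. -/
theorem injective_finInc_comp_subtype_at :
    Function.Injective ((finInc W).comp (torusFinAt W S).subtype) := by
  intro y y' h
  have h' : ((((y : torusFin W) : torusT W)) : GA W) = ((((y' : torusFin W) : torusT W)) : GA W) := h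
  exact Subtype.ext (Subtype.ext (Subtype.ext h'))

/-- The inclusion `T_f^{(S)} → G(𝔸)` is injective. -/
theorem injective_finInc_comp_subtype_away :
    Function.Injective ((finInc W).comp (torusFinAway W S).subtype) := by
  intro y y' h
  have h' : ((((y : torusFin W) : torusT W)) : GA W) = ((((y' : torusFin W) : torusT W)) : GA W) := h
  exact Subtype.ext (Subtype.ext (Subtype.ext h'))

/-- Membership in `Z_f ≤ T_f` (`ZfIn W`) is centrality of the underlying element. -/
theorem mem_ZfIn_iff (b : torusFin W) : b ∈ ZfIn W ↔ ((b : torusT W) : GA W) ∈ centre W := by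
  simp only [ZfIn, Subgroup.mem_subgroupOf]

/-- A central element of `T_S` (in the comap of the centre) commutes with every element of `T_S`. -/
theorem mul_comm_of_mem_comap_centre {z : torusFinAt W S}
    (hz : z ∈ (centre W).comap ((finInc W).comp (torusFinAt W S).subtype)) (x : torusFinAt W S) :
    z * x = x * z := by
  apply injective_finInc_comp_subtype_at W S
  rw [map_mul, map_mul]
  exact (Subgroup.mem_center_iff.1 (centre_le_center W (Subgroup.mem_comap.1 hz)) _).symm

end Inclusions

section Cover
variable {k : Type} [Field k] [NumberField k] (W : PlaneData k) (S : Set (HeightOneSpectrum (𝓞 k)))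

/-- **P3 pulled back to `T_S`**: `B(N)` is covered by at most `M` translates of `B(N D)` (`M = M(D)`, free of `N`). -/
theorem exists_finset_cover_levelAt_mul (D : ℕ) (hD : D ≠ 0) :
    ∃ M : ℕ, ∀ N : ℕ, N ≠ 0 → ∃ reps : Finset (torusFinAt W S), reps.card ≤ M ∧
      (((levelK W N).comap ((finInc W).comp (torusFinAt W S).subtype) : Subgroup (torusFinAt W S)) :
        Set (torusFinAt W S)) ⊆
        ⋃ g ∈ reps, g • (((levelK W (N * D)).comap ((finInc W).comp (torusFinAt W S).subtype) :
          Subgroup (torusFinAt W S)) : Set (torusFinAt W S)) := by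
  classical
  set ι : torusFinAt W S →* GA W := (finInc W).comp (torusFinAt W S).subtype with hι
  have hinj : Function.Injective ι := injective_finInc_comp_subtype_at W S
  obtain ⟨M, hM⟩ := exists_finset_cover_inf_levelK_mul W ι.range D hD
  refine ⟨M, fun N hN => ?_⟩
  obtain ⟨reps, hrepsH, hcard, hcov⟩ := hM N hN
  refine ⟨reps.image (Function.invFun ι), (Finset.card_image_le).trans hcard, ?_⟩
  intro y hy
  have hyK : ι y ∈ ι.range ⊓ levelK W N := ⟨⟨y, rfl⟩, hy⟩
  obtain ⟨g, hg, hmem⟩ := Set.mem_iUnion₂.1 (hcov hyK)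
  obtain ⟨h, hh, hgh⟩ := hmem
  have hgr : g ∈ ι.range := (hrepsH g hg).1
  obtain ⟨y₁, rfl⟩ : ∃ y₁, ι y₁ = h := hh.1
  have hlift : ι (Function.invFun ι g) = g := Function.invFun_eq hgr
  refine Set.mem_iUnion₂.2 ⟨Function.invFun ι g, Finset.mem_image_of_mem _ hg, y₁, hh.2, ?_⟩
  apply hinj
  show ι (Function.invFun ι g * y₁) = ι y
  simp only [smul_eq_mul] at hgh
  rw [map_mul, hlift]
  exact hgh

/-- **The saturated boxes are covered too**: with `Z_S` central, `(Z_S ⊓ B(1)) · B(N) ⊆ ⋃_{g ∈ reps} g • ((Z_S ⊓ B(1)) · B(N D))`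
whenever `B(N) ⊆ ⋃_{g ∈ reps} g • B(N D)`. -/
theorem saturated_subset_iUnion_smul {N N' : ℕ} {reps : Finset (torusFinAt W S)}
    (hcov : (((levelK W N).comap ((finInc W).comp (torusFinAt W S).subtype) : Subgroup (torusFinAt W S)) :
        Set (torusFinAt W S)) ⊆
      ⋃ g ∈ reps, g • (((levelK W N').comap ((finInc W).comp (torusFinAt W S).subtype) :
        Subgroup (torusFinAt W S)) : Set (torusFinAt W S))) :
    ((((centre W).comap ((finInc W).comp (torusFinAt W S).subtype) ⊓
        (levelK W 1).comap ((finInc W).comp (torusFinAt W S).subtype) : Subgroup (torusFinAt W S)) :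
        Set (torusFinAt W S)) *
      (((levelK W N).comap ((finInc W).comp (torusFinAt W S).subtype) : Subgroup (torusFinAt W S)) :
        Set (torusFinAt W S))) ⊆
      ⋃ g ∈ reps, g • ((((centre W).comap ((finInc W).comp (torusFinAt W S).subtype) ⊓
        (levelK W 1).comap ((finInc W).comp (torusFinAt W S).subtype) : Subgroup (torusFinAt W S)) :
        Set (torusFinAt W S)) *
      (((levelK W N').comap ((finInc W).comp (torusFinAt W S).subtype) : Subgroup (torusFinAt W S)) :
        Set (torusFinAt W S))) := by
  rintro x ⟨z, hz, b, hb, rfl⟩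
  obtain ⟨g, hg, hmem⟩ := Set.mem_iUnion₂.1 (hcov hb)
  obtain ⟨b₁, hb₁, rfl⟩ := hmem
  refine Set.mem_iUnion₂.2 ⟨g, hg, z * b₁, Set.mul_mem_mul hz hb₁, ?_⟩
  show g • (z * b₁) = z * (g • b₁)
  simp only [smul_eq_mul]
  rw [← mul_assoc, ← mul_comm_of_mem_comap_centre W S hz.1 g, mul_assoc]

end Cover

section Product
variable {k : Type} [Field k] [NumberField k] (W : PlaneData k) (S : Set (HeightOneSpectrum (𝓞 k)))

/-- **The split product lies in the saturated level box of `T_f`**: a pair `(z b, w)` with `z ∈ Z_S ⊓ B(1)`, `b ∈ B_S(qⁿ)`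
and `w ∈ B_A(1)` (the away level-one box) multiplies to an element of `(Z_f ∩ levelTf 1) · levelTf (qⁿ)`
(the away part at level one is at level `qⁿ`, `mem_levelK_pow_iff_of_mem_trivialOn`). -/
theorem preimage_split_prod_subset (q n : ℕ) :
    (torusFinSplit W (placesAbove (k := k) q)) ⁻¹'
      (((((centre W).comap ((finInc W).comp (torusFinAt W (placesAbove (k := k) q)).subtype) ⊓
          (levelK W 1).comap ((finInc W).comp (torusFinAt W (placesAbove (k := k) q)).subtype) :
          Subgroup (torusFinAt W (placesAbove (k := k) q))) : Set (torusFinAt W (placesAbove (k := k) q))) *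
        (((levelK W (q ^ n)).comap ((finInc W).comp (torusFinAt W (placesAbove (k := k) q)).subtype) :
          Subgroup (torusFinAt W (placesAbove (k := k) q))) : Set (torusFinAt W (placesAbove (k := k) q)))) ×ˢ
        (((levelK W 1).comap ((finInc W).comp (torusFinAway W (placesAbove (k := k) q)).subtype) :
          Subgroup (torusFinAway W (placesAbove (k := k) q))) : Set (torusFinAway W (placesAbove (k := k) q)))) ⊆
      ((ZfIn W : Set (torusFin W)) ∩ levelTf W 1) * levelTf W (q ^ n) := by
  intro e he
  rw [Set.mem_preimage, torusFinSplit_apply, Set.mem_prod] at he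
  obtain ⟨⟨z, hz, b₁, hb₁, hzb⟩, hw⟩ := he
  -- `e = atTf e * awayTf e = z * (b₁ * awayTf e)`
  have hsplit : e = ((atTf W (placesAbove (k := k) q) e : torusFin W)) *
      ((awayTf W (placesAbove (k := k) q) e : torusFin W)) := by
    have := (torusFinSplit W (placesAbove (k := k) q)).symm_apply_apply e
    rw [torusFinSplit_apply, torusFinSplit_symm_apply] at this
    exact this.symm
  have hzc : (((z : torusFin W) : torusT W) : GA W) ∈ centre W := Subgroup.mem_comap.1 hz.1
  have hz1 : (((z : torusFin W) : torusT W) : GA W) ∈ levelK W 1 := Subgroup.mem_comap.1 hz.2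
  have hb₁K : (((b₁ : torusFin W) : torusT W) : GA W) ∈ levelK W (q ^ n) := Subgroup.mem_comap.1 hb₁
  have hwK1 : (((awayTf W (placesAbove (k := k) q) e : torusFin W) : torusT W) : GA W) ∈ levelK W 1 :=
    Subgroup.mem_comap.1 hw
  have hwK : (((awayTf W (placesAbove (k := k) q) e : torusFin W) : torusT W) : GA W) ∈ levelK W (q ^ n) := by
    rw [mem_levelK_pow_iff_of_mem_trivialOn W (coe_coe_mem_finitePart W _)
      ((mem_torusFinAway W _ _).1 (awayTf W (placesAbove (k := k) q) e).2) n]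
    exact hwK1
  refine ⟨(z : torusFin W), ⟨(mem_ZfIn_iff W _).2 hzc, hz1⟩,
    (b₁ : torusFin W) * (awayTf W (placesAbove (k := k) q) e : torusFin W), ?_, ?_⟩
  · show ((((b₁ : torusFin W) * (awayTf W (placesAbove (k := k) q) e : torusFin W) : torusFin W) : torusT W) : GA W) ∈
      levelK W (q ^ n)
    rw [Subgroup.coe_mul, Subgroup.coe_mul]
    exact (levelK W (q ^ n)).mul_mem hb₁K hwK
  · have hzb' : (z : torusFin W) * (b₁ : torusFin W) = (atTf W (placesAbove (k := k) q) e : torusFin W) := by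
      have := congrArg (fun y : torusFinAt W (placesAbove (k := k) q) => (y : torusFin W)) hzb
      simpa [Subgroup.coe_mul] using this
    show (z : torusFin W) * ((b₁ : torusFin W) * (awayTf W (placesAbove (k := k) q) e : torusFin W)) = e
    rw [← mul_assoc, hzb', ← hsplit]

end Product

section Measure
variable {k : Type} [Field k] [NumberField k] (W : PlaneData k) (S : Set (HeightOneSpectrum (𝓞 k)))
  [MeasurableSpace (torusT W)] [BorelSpace (torusT W)]

/-- **`ν_f` of a split product**: for `ν_f = c • (ν_S ⊗ ν_A)` along the split, `ν_f(split⁻¹(A ×ˢ B)) = c · ν_S(A) · ν_A(B)` —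
for ALL sets `A`, `B` (the split is a measurable equivalence; `Measure.prod_prod` needs no measurability). -/
theorem measure_preimage_split_prod (νf : Measure (torusFin W)) (νS : Measure (torusFinAt W S)) [SFinite νS]
    (νA : Measure (torusFinAway W S)) [SFinite νA]
    (c : ℝ≥0) (hc : νf = c • Measure.map (torusFinSplit W S).symm (νS.prod νA))
    (A : Set (torusFinAt W S)) (B : Set (torusFinAway W S)) :
    νf ((torusFinSplit W S) ⁻¹' (A ×ˢ B)) = (c : ℝ≥0∞) * (νS A * νA B) := by
  haveI : BorelSpace (torusFin W) := Subtype.borelSpace _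
  haveI : BorelSpace (torusFinAt W S) := Subtype.borelSpace _
  haveI : BorelSpace (torusFinAway W S) := Subtype.borelSpace _
  haveI := secondCountable_torusFinAt W S
  haveI := secondCountable_torusFinAway W S
  have hmeq : Measure.map (torusFinSplit W S).symm (νS.prod νA) =
      Measure.map ((torusFinSplit W S).symm.toHomeomorph.toMeasurableEquiv) (νS.prod νA) := rfl
  have hpre : (torusFinSplit W S).symm.toHomeomorph.toMeasurableEquiv ⁻¹'
      ((torusFinSplit W S) ⁻¹' (A ×ˢ B)) = A ×ˢ B := by
    ext p
    simp only [Set.mem_preimage, Homeomorph.toMeasurableEquiv_coe]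
    show (torusFinSplit W S) ((torusFinSplit W S).symm p) ∈ A ×ˢ B ↔ p ∈ A ×ˢ B
    rw [ContinuousMulEquiv.apply_symm_apply]
  rw [hc, Measure.smul_apply, hmeq, MeasurableEquiv.map_apply, hpre, Measure.prod_prod, ENNReal.smul_def, smul_eq_mul]

end Measure

section Main
variable {k : Type} [Field k] [NumberField k] (W : PlaneData k) [MeasurableSpace (torusT W)] [BorelSpace (torusT W)]

/-- **C-L4-CURRENCY — THE CURRENCY MATCH**: `S = placesAbove q`, `ν_f = c • (ν_S ⊗ ν_A)` (P1), `C ⊆ T_f` compact: there is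
`M₃ < ⊤` with, for every `n`,
`c · ν_S((Z_S ⊓ B(1)) · B(qⁿ)) · ν_A(π^{(q)} C) ≤ M₃ · ν_f((Z_f ∩ levelTf 1) · levelTf (q^{n+c₀}))`
(`M₃ = M(q^{c₀}) · m_A`: P3's covering number of `B(qⁿ)` by translates of `B(q^{n+c₀})` times the number of level-one
cosets covering the compact away part of `C`). -/
theorem currency_match (q c₀ : ℕ) (hq : q ≠ 0)
    (νf : Measure (torusFin W)) [νf.IsHaarMeasure]
    (νS : Measure (torusFinAt W (placesAbove (k := k) q))) [νS.IsHaarMeasure]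
    (νA : Measure (torusFinAway W (placesAbove (k := k) q))) [νA.IsHaarMeasure]
    (c : ℝ≥0) (hc : νf = c • Measure.map (torusFinSplit W (placesAbove (k := k) q)).symm (νS.prod νA))
    {C : Set (torusFin W)} (hC : IsCompact C) :
    ∃ M₃ : ℝ≥0∞, M₃ ≠ ⊤ ∧ ∀ n : ℕ,
      (c : ℝ≥0∞) *
        νS ((((centre W).comap ((finInc W).comp (torusFinAt W (placesAbove (k := k) q)).subtype) ⊓
            (levelK W 1).comap ((finInc W).comp (torusFinAt W (placesAbove (k := k) q)).subtype) :
            Subgroup (torusFinAt W (placesAbove (k := k) q))) : Set (torusFinAt W (placesAbove (k := k) q))) *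
          (((levelK W (q ^ n)).comap ((finInc W).comp (torusFinAt W (placesAbove (k := k) q)).subtype) :
            Subgroup (torusFinAt W (placesAbove (k := k) q))) : Set (torusFinAt W (placesAbove (k := k) q)))) *
        νA (awayTf W (placesAbove (k := k) q) '' C) ≤
      M₃ * νf (((ZfIn W : Set (torusFin W)) ∩ levelTf W 1) * levelTf W (q ^ (n + c₀))) := by
  classical
  haveI : BorelSpace (torusFin W) := Subtype.borelSpace _
  haveI : BorelSpace (torusFinAt W (placesAbove (k := k) q)) := Subtype.borelSpace _
  haveI : BorelSpace (torusFinAway W (placesAbove (k := k) q)) := Subtype.borelSpace _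
  haveI := secondCountable_torusFinAt W (placesAbove (k := k) q)
  haveI := secondCountable_torusFinAway W (placesAbove (k := k) q)
  haveI := locallyCompact_torusFinAt W (placesAbove (k := k) q)
  haveI := locallyCompact_torusFinAway W (placesAbove (k := k) q)
  haveI : IsLocallyFiniteMeasure νS := isLocallyFiniteMeasure_of_isFiniteMeasureOnCompacts
  haveI : SigmaFinite νS := sigmaFinite_of_locallyFinite
  haveI : IsLocallyFiniteMeasure νA := isLocallyFiniteMeasure_of_isFiniteMeasureOnCompacts
  haveI : SigmaFinite νA := sigmaFinite_of_locallyFinite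
  -- (i) P3 on `T_S` with `D := q ^ c₀`
  obtain ⟨M, hM⟩ := exists_finset_cover_levelAt_mul W (placesAbove (k := k) q) (q ^ c₀) (pow_ne_zero _ hq)
  -- (ii) the away level-one box is open; the compact `π^{(q)} C` is covered by finitely many of its cosets
  have hBAopen : IsOpen ((((levelK W 1).comap ((finInc W).comp (torusFinAway W (placesAbove (k := k) q)).subtype) :
      Subgroup (torusFinAway W (placesAbove (k := k) q))) : Set (torusFinAway W (placesAbove (k := k) q)))) :=
    isOpen_preimage_levelK_of_continuous W one_ne_zero
      (continuous_subtype_val.comp (continuous_subtype_val.comp continuous_subtype_val))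
      (fun w => coe_coe_mem_finitePart W _)
  obtain ⟨F, hF⟩ := exists_finset_cover_smul_of_isCompact _ hBAopen
    (hC.image (continuous_awayTf W (placesAbove (k := k) q)))
  refine ⟨(M : ℝ≥0∞) * F.card, ENNReal.mul_ne_top (ENNReal.natCast_ne_top M) (ENNReal.natCast_ne_top F.card),
    fun n => ?_⟩
  obtain ⟨reps, hcard, hcov⟩ := hM (q ^ n) (pow_ne_zero _ hq)
  rw [← pow_add] at hcov
  have hsat := saturated_subset_iUnion_smul W (placesAbove (k := k) q) hcov
  -- the two covering bounds
  have h1 := measure_le_card_mul_of_subset_biUnion_smul νS hsat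
  have h2 := measure_le_card_mul_of_subset_biUnion_smul νA hF
  have hcardM : (reps.card : ℝ≥0∞) ≤ M := by exact_mod_cast hcard
  -- assemble
  calc (c : ℝ≥0∞) * νS _ * νA (awayTf W (placesAbove (k := k) q) '' C)
      ≤ (c : ℝ≥0∞) * (reps.card * νS _) * (F.card * νA _) := by gcongr
    _ ≤ (c : ℝ≥0∞) * (M * νS _) * (F.card * νA _) := by gcongr
    _ = ((M : ℝ≥0∞) * F.card) * ((c : ℝ≥0∞) * (νS _ * νA _)) := by ring
    _ = ((M : ℝ≥0∞) * F.card) * νf ((torusFinSplit W (placesAbove (k := k) q)) ⁻¹' (_ ×ˢ _)) := by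
        rw [measure_preimage_split_prod W (placesAbove (k := k) q) νf νS νA c hc]
    _ ≤ ((M : ℝ≥0∞) * F.card) * νf (((ZfIn W : Set (torusFin W)) ∩ levelTf W 1) * levelTf W (q ^ (n + c₀))) := by
        gcongr
        exact preimage_split_prod_subset W q (n + c₀)

end Main

end Summit.Ventures.HodgeRepro.Tier4.Line4

end
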